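import Literature.NumberTheory.EllipticCurves.PoonenRainsKummerChords
import Literature.NumberTheory.EllipticCurves.ThetaIsotropyIdentities
import HarnessLib

/-!
# Kummer isotropy for the Poonen–Rains form at level `2`, II: the theta cocycle of a Kummer cocycle is a coboundary over `L̄`

Setting as in `PoonenRainsKummerChords`: `E/K` (model `W`, `2 ≠ 0`), a `K`-field `L`, `F = L̄ ⊇ K̄` via
`ι = closureEmb L`, `Q = (x_Q, y_Q) ∈ E(F)` with `2Q ∈ E(L)` and `2Q ≠ O`, local Kummer cocycle
`ξ_σ = θ⁻¹(σQ − Q)`.  With `u = frame ξ_σ`, `v = frame ξ_τ`, `w = frame(θσ ξ_τ)`, `e′ = ι ∘ e` (`eL`),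
`s′ = ι ∘ s` (`sL`):

* `abscL_smul_eq_translAbsc` — `x(σQ) = translAbsc e′ x_Q u` (`= x_Q` or `e′ᵢ + D′ᵢ/(x_Q − e′ᵢ)`);
* `smul_Aof` — `σ · A_Q(v) = A_{σQ}(w)` for the cochain `A_Q(v) = x_Q − e′_v`;
* `closureEmb_conn_eq` — **`ι(conn ξ (σ,τ)) = B(σ) · σB(τ) / B(στ)`**, `B(σ) := s′_u / A_Q(u)`
  (`coe_toMul_conn_heisenbergGm_comap` + `A_mul_A_mul_table`);
* `etaL_smul`, `etaL_smul_mul_sub` — `η(σP) = σ η(P)` and the chord relation (Y) along the cocycle.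

The sequel (`PoonenRainsKummerIsotropyClass`) turns `B` into the sign cochain `ℓ = B·β/σβ` and concludes
`prClass (κ(Q)) = 0` (Poonen–Rains 2012 Prop. 4.8).  References: [PoonenRains2012] §4.1, Prop. 4.8;
[SilvermanAEC2009] III.2.3, VIII.§2.  No named fact.
-/

set_option autoImplicit false

noncomputable section

open scoped Classical

namespace Literature.NumberTheory.EllipticCurves

namespace ThetaLevelTwo

open Literature.Algebra.Homology
open Literature.NumberTheory.GaloisRepresentations Literature.NumberTheory.GaloisRepresentations.DiscreteGaloisModule
open Literature.NumberTheory.EllipticCurves.DokchitserDokchitser2012 (vec idx frame T xT permGal T_permGal smul_xT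
  xT_injective coe_T_ne_zero eq_zero_or_eq_T)
open WeierstrassCurve Field

universe u

/-- `A_Q(v) ≠ 0` when `x_Q ≠ eᵢ` for all `i`. [cite: PoonenRains2012, Prop. 4.8 (isotropy of the Kummer image)] -/
theorem Aof_ne_zero {M : Type*} [Field M] {e : Fin 3 → M} {x : M} (hx : ∀ i, x ≠ e i) (v : V) :
    Aof e x v ≠ 0 := by
  unfold Aof
  split_ifs with h
  · exact one_ne_zero
  · exact sub_ne_zero.mpr (hx _)

variable {K : Type u} [Field K] (W : WeierstrassCurve K) [W.IsElliptic] (h2 : (2 : K) ≠ 0)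
variable (L : Type u) [Field L] [Algebra K L]

/-! ### Frame letters, embedded roots and square roots -/

/-- `frame (Tᵢ) = vᵢ`. [cite: SilvermanAEC2009, III.§7 (the representation on E[m])] -/
theorem frame_T (i : Fin 3) : frame W h2 (T W h2 i) = vec i := by
  show frame W h2 ((frame W h2).symm (vec i)) = vec i
  exact (frame W h2).apply_symm_apply _

/-- The embedded roots `e′ᵢ = ι(xᵢ) ∈ L̄`. [cite: PoonenRains2012, §4.1 (functoriality in the field)] -/
def eL : Fin 3 → AlgebraicClosure L := fun i => closureEmb (K := K) L (xT W h2 i)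

/-- `e′` is injective. [cite: SilvermanAEC2009, III.2.3 (points with equal abscissa)] -/
theorem eL_injective : Function.Injective (eL W h2 L) := fun _ _ hij =>
  xT_injective W h2 ((closureEmb (K := K) L).injective hij)

/-- `ι` of the theta table is the table of the embedded roots. [cite: PoonenRains2012, Prop. 4.5 (the Heisenberg group)] -/
theorem closureEmb_gmTable (v w : V) :
    closureEmb (K := K) L ((thetaData W h2).gmTable v w) = tableOf (eL W h2 L) v w := by
  rw [ThetaData.gmTable_eq_tableOf]
  unfold tableOf Dof eL
  show closureEmb L (if v = 0 ∨ w = 0 then 1 else if v = w then _ else _) = _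
  split_ifs <;> simp [map_sub, map_mul, thetaData]

/-- `σ(e′_{frame P}) = e′_{frame(θσ P)}` for `P ≠ 0`. [cite: SilvermanAEC2009, VIII.§1 (Galois acts coordinatewise)] -/
theorem smul_eL_idx_frame (σ : absoluteGaloisGroup L) {P : geomTorsion W 2} (hP : P ≠ 0) :
    σ • eL W h2 L (idx (frame W h2 P)) = eL W h2 L (idx (frame W h2 (absGaloisRestrict K L σ • P))) := by
  rcases eq_zero_or_eq_T W h2 P with h | ⟨i, rfl⟩
  · exact absurd h hP
  rw [← T_permGal, frame_T, frame_T]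
  unfold eL
  have hidx : ∀ j : Fin 3, idx (vec j) = j := by decide
  rw [← closureEmb_smul, smul_xT, hidx, hidx]

/-- The embedded square roots `s′_v = ι(s_v)` (`s′_O = 1`). [cite: PoonenRains2012, §4.1 (the Heisenberg group)] -/
def sL (v : V) : AlgebraicClosure L :=
  closureEmb (K := K) L (((thetaData W h2).sUnit v : (AlgebraicClosure K)ˣ) : AlgebraicClosure K)

/-- Unfolding `sL`. [cite: PoonenRains2012, §4.1 (the Heisenberg group)] -/
theorem closureEmb_coe_sUnit (v : V) :
    closureEmb (K := K) L (((thetaData W h2).sUnit v : (AlgebraicClosure K)ˣ) : AlgebraicClosure K) = sL W h2 L v :=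
  rfl

/-- `s′_v ≠ 0`. [cite: PoonenRains2012, §4.1 (the Heisenberg group)] -/
theorem sL_ne_zero (v : V) : sL W h2 L v ≠ 0 := by
  rw [sL, map_ne_zero]
  exact ((thetaData W h2).sUnit v).ne_zero

/-- `s′_O = 1`. [cite: PoonenRains2012, §4.1 (the Heisenberg group)] -/
@[simp] theorem sL_zero : sL W h2 L 0 = 1 := by
  simp [sL]

/-- `s′ᵢ² = −D′ᵢ`. [cite: PoonenRains2012, §4.1 (the Heisenberg group)] -/
theorem sL_vec_sq (i : Fin 3) : sL W h2 L (vec i) ^ 2 = -Dof (eL W h2 L) i := by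
  rw [sL, ThetaData.coe_sUnit_vec, ← map_pow, (thetaData W h2).s_sq i]
  simp only [map_neg, map_mul, map_sub, Dof, eL]
  rfl

/-- **`σ · A_Q(v) = A_{σQ}(w)`**: `σ(x_Q − e′_{frame P}) = σx_Q − e′_{frame(θσ P)}`.
[cite: SilvermanAEC2009, VIII.§1 (Galois acts coordinatewise)] -/
theorem smul_Aof (σ : absoluteGaloisGroup L) (xQ : AlgebraicClosure L) (P : geomTorsion W 2) :
    σ • Aof (eL W h2 L) xQ (frame W h2 P)
      = Aof (eL W h2 L) (σ • xQ) (frame W h2 (absGaloisRestrict K L σ • P)) := by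
  by_cases hP : P = 0
  · subst hP
    simp [Aof]
  · have hP' : absGaloisRestrict K L σ • P ≠ 0 := by
      intro h
      apply hP
      have := congrArg (fun R => (absGaloisRestrict K L σ)⁻¹ • R) h
      simpa using this
    have h1 : frame W h2 P ≠ 0 := fun h => hP ((frame W h2).map_eq_zero_iff.mp h)
    have h2' : frame W h2 (absGaloisRestrict K L σ • P) ≠ 0 := fun h => hP' ((frame W h2).map_eq_zero_iff.mp h)
    simp only [Aof, h1, h2', if_false, smul_sub, smul_eL_idx_frame W h2 L σ hP]

/-! ### Coordinates on `E(L̄)` -/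

/-- The abscissa of a point of `E(L̄)` (`O ↦ 0`, a junk value). [cite: SilvermanAEC2009, III.2.3 (coordinates of points)] -/
def abscL (P : localPoints W L) : AlgebraicClosure L :=
  match (P : (W.baseChange (AlgebraicClosure L)).toAffine.Point) with
  | 0 => 0
  | .some x _ _ => x

/-- `η(P) = 2y + a₁x + a₃` of a point of `E(L̄)` (`O ↦ 0`, junk). [cite: SilvermanAEC2009, III.1 (completing the square)] -/
def etaL (P : localPoints W L) : AlgebraicClosure L :=
  match (P : (W.baseChange (AlgebraicClosure L)).toAffine.Point) with
  | 0 => 0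
  | .some x y _ => 2 * y + (W.baseChange (AlgebraicClosure L)).a₁ * x + (W.baseChange (AlgebraicClosure L)).a₃

omit [W.IsElliptic] in
/-- `abscL (x, y) = x`. [cite: SilvermanAEC2009, III.2.3 (coordinates of points)] -/
theorem abscL_of_eq {P : localPoints W L} {x y : AlgebraicClosure L}
    {h : (W.baseChange (AlgebraicClosure L)).toAffine.Nonsingular x y}
    (hP : (P : (W.baseChange (AlgebraicClosure L)).toAffine.Point) = Affine.Point.some x y h) :
    abscL W L P = x := by
  unfold abscL; rw [hP]

omit [W.IsElliptic] in
/-- `etaL (x, y) = 2y + a₁x + a₃`. [cite: SilvermanAEC2009, III.1 (completing the square)] -/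
theorem etaL_of_eq {P : localPoints W L} {x y : AlgebraicClosure L}
    {h : (W.baseChange (AlgebraicClosure L)).toAffine.Nonsingular x y}
    (hP : (P : (W.baseChange (AlgebraicClosure L)).toAffine.Point) = Affine.Point.some x y h) :
    etaL W L P = 2 * y + (W.baseChange (AlgebraicClosure L)).a₁ * x + (W.baseChange (AlgebraicClosure L)).a₃ := by
  unfold etaL; rw [hP]

omit [W.IsElliptic] in
/-- The Galois action on `E(L̄)` is coordinatewise: `x(σP) = σ x(P)`. [cite: SilvermanAEC2009, VIII.§1 (Galois acts coordinatewise)] -/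
theorem abscL_smul (σ : absoluteGaloisGroup L) (P : localPoints W L) : abscL W L (σ • P) = σ • abscL W L P := by
  rw [localPoints.smul_def]
  change (W.baseChange (AlgebraicClosure L)).toAffine.Point at P
  rcases P with _ | ⟨x, y, h⟩
  · show abscL W L 0 = σ • (0 : AlgebraicClosure L)
    rw [smul_zero]; rfl
  · rfl

omit [W.IsElliptic] in
/-- `σ` fixes the coefficients `aᵢ ∈ K` of the base-changed curve. [cite: SilvermanAEC2009, VIII.§1 (Galois acts coordinatewise)] -/
theorem smul_algebraMap_eq (σ : absoluteGaloisGroup L) (a : K) :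
    σ • algebraMap K (AlgebraicClosure L) a = algebraMap K (AlgebraicClosure L) a := by
  rw [IsScalarTower.algebraMap_apply K L (AlgebraicClosure L)]
  exact (show AlgebraicClosure L ≃ₐ[L] AlgebraicClosure L from σ).commutes _

omit [W.IsElliptic] in
/-- `η(σP) = σ η(P)`. [cite: SilvermanAEC2009, VIII.§1 (Galois acts coordinatewise)] -/
theorem etaL_smul (σ : absoluteGaloisGroup L) (P : localPoints W L) : etaL W L (σ • P) = σ • etaL W L P := by
  have ha₁ : σ • (W.baseChange (AlgebraicClosure L)).a₁ = (W.baseChange (AlgebraicClosure L)).a₁ :=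
    smul_algebraMap_eq L σ W.a₁
  have ha₃ : σ • (W.baseChange (AlgebraicClosure L)).a₃ = (W.baseChange (AlgebraicClosure L)).a₃ :=
    smul_algebraMap_eq L σ W.a₃
  have h2σ : σ • (2 : AlgebraicClosure L) = 2 := by
    have := smul_algebraMap_eq L σ (2 : K)
    rwa [map_ofNat] at this
  rw [localPoints.smul_def]
  change (W.baseChange (AlgebraicClosure L)).toAffine.Point at P
  rcases P with _ | ⟨x, y, h⟩
  · show etaL W L 0 = σ • (0 : AlgebraicClosure L)
    rw [smul_zero]; rfl
  · show 2 * σ • y + _ * σ • x + _ = σ • (2 * y + _ * x + _)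
    rw [smul_add, smul_add, smul_mul', smul_mul', ha₁, ha₃, h2σ]

/-- For `Q = (x_Q, y_Q)` with `Q + Q ≠ O`: `x_Q ≠ e′ᵢ` (else `Q = ± ι Tᵢ` would be `2`-torsion).
[cite: SilvermanAEC2009, III.2.3 (points with equal abscissa are P or −P)] -/
theorem ne_eL_of_add_self_ne_zero {xQ yQ : AlgebraicClosure L}
    (hQ : (W.baseChange (AlgebraicClosure L)).toAffine.Nonsingular xQ yQ)
    (h2Q : Affine.Point.some xQ yQ hQ + Affine.Point.some xQ yQ hQ ≠ 0) (i : Fin 3) :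
    xQ ≠ eL W h2 L i := by
  intro hx
  obtain ⟨x, y, h, hT, hxT⟩ := exists_coe_T_eq_some W h2 i
  obtain ⟨h', hmap⟩ := pointsMap_some W L h
  have h2T' : pointsMap W L ((T W h2 i : geomPoints W) + (T W h2 i : geomPoints W)) = 0 := by
    rw [DokchitserDokchitser2012.coe_add_self_eq_zero W, map_zero]
  rw [map_add, hT, hmap] at h2T'
  have h2T : (Affine.Point.some _ _ h' : (W.baseChange (AlgebraicClosure L)).toAffine.Point)
      + Affine.Point.some _ _ h' = 0 := h2T'
  have hx' : xQ = closureEmb (K := K) L x := by rw [hx, eL, hxT]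
  rcases Affine.Y_eq_of_X_eq hQ.1 h'.1 hx' with hy | hy
  · apply h2Q
    have : Affine.Point.some xQ yQ hQ = Affine.Point.some _ _ h' := by simp only [hx', hy]
    rw [this]; exact h2T
  · apply h2Q
    have : Affine.Point.some xQ yQ hQ = -Affine.Point.some _ _ h' := by
      rw [Affine.Point.neg_some]; simp only [hx', hy]
    rw [this, ← neg_add, h2T, neg_zero]

omit [W.IsElliptic] in
/-- For `Q = (x_Q, y_Q)` with `Q + Q ≠ O`: `η(Q) ≠ 0`. [cite: SilvermanAEC2009, III.2.3 (d) (doubling)] -/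
theorem eta_ne_zero_of_add_self_ne_zero {xQ yQ : AlgebraicClosure L}
    (hQn : (W.baseChange (AlgebraicClosure L)).toAffine.Nonsingular xQ yQ)
    (h2Q : Affine.Point.some xQ yQ hQn + Affine.Point.some xQ yQ hQn ≠ 0) :
    2 * yQ + (W.baseChange (AlgebraicClosure L)).a₁ * xQ + (W.baseChange (AlgebraicClosure L)).a₃ ≠ 0 :=
  fun h => h2Q ((TwoTorsionChord.eta_eq_zero_iff_add_self_eq_zero _ hQn).mp h)

/-! ### Along the Kummer cocycle -/

variable [CharZero K]

section Cocycle

variable (Q : localPoints W L) {xQ yQ : AlgebraicClosure L}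
  (hQn : (W.baseChange (AlgebraicClosure L)).toAffine.Nonsingular xQ yQ)
  (hQe : (Q : (W.baseChange (AlgebraicClosure L)).toAffine.Point) = Affine.Point.some xQ yQ hQn)
  (hQ : (2 : ℤ) • Q ∈ MulAction.fixedPoints (absoluteGaloisGroup L) (localPoints W L))
  (h2Q : Affine.Point.some xQ yQ hQn + Affine.Point.some xQ yQ hQn ≠ 0)

include hQe h2Q in
/-- `σQ = Q + ι Tᵢ` has coordinates given by the chord formulas when `ξ_σ = Tᵢ`.
[cite: SilvermanAEC2009, III.2.3 (the chord through P and T)] -/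
theorem smul_eq_some_add (σ : absoluteGaloisGroup L) {i : Fin 3}
    (hi : ((W.localKummerCocycle 2 two_ne_zero Q hQ).1 σ : geomTorsion W 2) = T W h2 i)
    {y : AlgebraicClosure K} {h : (W.baseChange (AlgebraicClosure K)).toAffine.Nonsingular (xT W h2 i) y}
    (hT : (T W h2 i : geomPoints W) = Affine.Point.some (xT W h2 i) y h) :
    ∃ h', (σ • Q : (W.baseChange (AlgebraicClosure L)).toAffine.Point) =
      Affine.Point.some
        ((W.baseChange (AlgebraicClosure L)).toAffine.addX xQ (closureEmb (K := K) L (xT W h2 i))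
          ((W.baseChange (AlgebraicClosure L)).toAffine.slope xQ (closureEmb (K := K) L (xT W h2 i)) yQ
            (closureEmb (K := K) L y)))
        ((W.baseChange (AlgebraicClosure L)).toAffine.addY xQ (closureEmb (K := K) L (xT W h2 i)) yQ
          ((W.baseChange (AlgebraicClosure L)).toAffine.slope xQ (closureEmb (K := K) L (xT W h2 i)) yQ
            (closureEmb (K := K) L y))) h' := by
  obtain ⟨h', hmap⟩ := pointsMap_some W L h
  have hx : xQ ≠ closureEmb (K := K) L (xT W h2 i) := ne_eL_of_add_self_ne_zero W h2 L hQn h2Q i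
  refine ⟨Affine.nonsingular_add hQn h' fun hxy => hx hxy.1, ?_⟩
  rw [smul_eq_add_pointsMap W L Q hQ σ, hi, hT, hmap]
  show (show (W.baseChange (AlgebraicClosure L)).toAffine.Point from Q) + Affine.Point.some _ _ h' = _
  rw [hQe]
  exact Affine.Point.add_of_X_ne hx

include hQe h2Q in
/-- **The abscissa of `σQ`**: `x(σ • Q) = translAbsc e′ x_Q (frame ξ_σ)` (`x_Q` if `ξ_σ = 0`,
`e′ᵢ + D′ᵢ/(x_Q − e′ᵢ)` if `ξ_σ = Tᵢ`). [cite: SilvermanAEC2009, III.2.3 (translation by a 2-torsion point)] -/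
theorem abscL_smul_eq_translAbsc (σ : absoluteGaloisGroup L) :
    abscL W L (σ • Q)
      = translAbsc (eL W h2 L) xQ (frame W h2 ((W.localKummerCocycle 2 two_ne_zero Q hQ).1 σ : geomTorsion W 2)) := by
  rcases eq_zero_or_eq_T W h2 ((W.localKummerCocycle 2 two_ne_zero Q hQ).1 σ) with h0 | ⟨i, hi⟩
  · rw [h0, translAbsc, if_pos (map_zero _), smul_eq_add_pointsMap W L Q hQ σ, h0, ZeroMemClass.coe_zero,
      map_zero, add_zero]
    exact abscL_of_eq W L hQe
  · rw [hi, frame_T, translAbsc, if_neg (by fin_cases i <;> decide)]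
    obtain ⟨x, y, h, hT, hxT⟩ := exists_coe_T_eq_some W h2 i
    subst hxT
    obtain ⟨h', hσQ⟩ := smul_eq_some_add W h2 L Q hQn hQe hQ h2Q σ hi hT
    have hx : xQ ≠ closureEmb (K := K) L (xT W h2 i) := ne_eL_of_add_self_ne_zero W h2 L hQn h2Q i
    have hidx : idx (vec i) = i := by fin_cases i <;> decide
    rw [hidx, abscL_of_eq W L hσQ, addX_closureEmb_xT_eq W h2 L hQn i hx y h hT]
    simp only [eL, Dof, Droot, map_mul, map_sub]

include hQe h2Q in
/-- **The chord relation (Y) along the Kummer cocycle**: if `ξ_σ = Tᵢ` then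
`η(σQ)·(x_Q − e′ᵢ) = −η(Q)·(x(σQ) − e′ᵢ)`. [cite: SilvermanAEC2009, III.2.3 (the chord through P and T)] -/
theorem etaL_smul_mul_sub (σ : absoluteGaloisGroup L) {i : Fin 3}
    (hi : ((W.localKummerCocycle 2 two_ne_zero Q hQ).1 σ : geomTorsion W 2) = T W h2 i) :
    etaL W L (σ • Q) * (xQ - eL W h2 L i)
      = -((2 * yQ + (W.baseChange (AlgebraicClosure L)).a₁ * xQ + (W.baseChange (AlgebraicClosure L)).a₃)
          * (translAbsc (eL W h2 L) xQ (vec i) - eL W h2 L i)) := by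
  have habs := abscL_smul_eq_translAbsc W h2 L Q hQn hQe hQ h2Q σ
  rw [hi, frame_T] at habs
  rw [← habs]
  obtain ⟨x, y, h, hT, hxT⟩ := exists_coe_T_eq_some W h2 i
  subst hxT
  obtain ⟨h', hσQ⟩ := smul_eq_some_add W h2 L Q hQn hQe hQ h2Q σ hi hT
  obtain ⟨h'', hmap⟩ := pointsMap_some W L h
  have hx : xQ ≠ closureEmb (K := K) L (xT W h2 i) := ne_eL_of_add_self_ne_zero W h2 L hQn h2Q i
  -- `η(ι Tᵢ) = 0`
  have h2T' : pointsMap W L ((T W h2 i : geomPoints W) + (T W h2 i : geomPoints W)) = 0 := by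
    rw [DokchitserDokchitser2012.coe_add_self_eq_zero W, map_zero]
  rw [map_add, hT, hmap] at h2T'
  have ht : 2 * closureEmb (K := K) L y + (W.baseChange (AlgebraicClosure L)).a₁ * closureEmb (K := K) L (xT W h2 i)
      + (W.baseChange (AlgebraicClosure L)).a₃ = 0 :=
    (TwoTorsionChord.eta_eq_zero_iff_add_self_eq_zero (W.baseChange (AlgebraicClosure L)) h'').mpr h2T'
  rw [etaL_of_eq W L hσQ, abscL_of_eq W L hσQ]
  exact TwoTorsionChord.eta_add_mul_sub (W := W.baseChange (AlgebraicClosure L)) (y₁ := yQ) ht hx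

include hQe h2Q in
/-- **`ι(conn ξ (σ,τ)) = B(σ) · σB(τ) / B(στ)`** with `B(σ) = s′_{frame ξσ}/A_Q(frame ξσ)`, for the local
Kummer cocycle `ξ` of `Q = (x_Q, y_Q)`, `2Q ≠ O`: the `K̄ˣ`-valued theta cocycle is a coboundary over `L̄`
(`coe_toMul_conn_heisenbergGm_comap` + `A_mul_A_mul_table`). [cite: PoonenRains2012, Prop. 4.8 (isotropy of the Kummer image)] -/
theorem closureEmb_conn_eq (σ τ : absoluteGaloisGroup L) :
    closureEmb (K := K) L
        ((Additive.toMul (((heisenbergGm W h2).comap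
          (absGaloisRestrict K L : absoluteGaloisGroup L →ₜ* absoluteGaloisGroup K).toMonoidHom).conn
            (cocycleFun W L (W.localKummerCocycle 2 two_ne_zero Q hQ)) σ τ)
            : (AlgebraicClosure K)ˣ) : AlgebraicClosure K)
      = (sL W h2 L (frame W h2 ((W.localKummerCocycle 2 two_ne_zero Q hQ).1 σ : geomTorsion W 2))
          / Aof (eL W h2 L) xQ (frame W h2 ((W.localKummerCocycle 2 two_ne_zero Q hQ).1 σ : geomTorsion W 2)))
        * (σ • (sL W h2 L (frame W h2 ((W.localKummerCocycle 2 two_ne_zero Q hQ).1 τ : geomTorsion W 2))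
          / Aof (eL W h2 L) xQ (frame W h2 ((W.localKummerCocycle 2 two_ne_zero Q hQ).1 τ : geomTorsion W 2))))
        / (sL W h2 L (frame W h2 ((W.localKummerCocycle 2 two_ne_zero Q hQ).1 (σ * τ) : geomTorsion W 2))
          / Aof (eL W h2 L) xQ (frame W h2 ((W.localKummerCocycle 2 two_ne_zero Q hQ).1 (σ * τ) : geomTorsion W 2))) := by
  set ξ := W.localKummerCocycle 2 two_ne_zero Q hQ with hξdef
  have hξ : ((heisenbergGm W h2).comap
      (absGaloisRestrict K L : absoluteGaloisGroup L →ₜ* absoluteGaloisGroup K).toMonoidHom).IsCrossedHom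
      (cocycleFun W L ξ) :=
    fun g h => isCrossedHom_of_mem W h2 L ξ g h
  have hx : ∀ i, xQ ≠ eL W h2 L i := ne_eL_of_add_self_ne_zero W h2 L hQn h2Q
  have hθ : ∀ g, (absGaloisRestrict K L : absoluteGaloisGroup L →ₜ* absoluteGaloisGroup K).toMonoidHom g
      = absGaloisRestrict K L g := fun g => rfl
  rw [coe_toMul_conn_heisenbergGm_comap W h2 _ (cocycleFun W L ξ) hξ σ τ]
  simp only [map_mul, map_div₀, hθ, closureEmb_smul, closureEmb_gmTable, closureEmb_coe_sUnit, cocycleFun_apply]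
  -- the crossed-homomorphism relation in the frame
  have hστ : (ξ.1 (σ * τ) : geomTorsion W 2) = ξ.1 σ + absGaloisRestrict K L σ • ξ.1 τ := hξ σ τ
  have hframe : frame W h2 (ξ.1 (σ * τ)) = frame W h2 (ξ.1 σ) + frame W h2 (absGaloisRestrict K L σ • ξ.1 τ) := by
    rw [hστ, map_add]
  -- the `A`-identity with `x(σQ)` and `σ A_Q(v)` substituted
  have hA := A_mul_A_mul_table (eL_injective W h2 L) hx (frame W h2 (ξ.1 σ))
    (frame W h2 (absGaloisRestrict K L σ • ξ.1 τ))
  have htr : translAbsc (eL W h2 L) xQ (frame W h2 (ξ.1 σ)) = σ • xQ := by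
    rw [← abscL_smul_eq_translAbsc W h2 L Q hQn hQe hQ h2Q σ, abscL_smul, abscL_of_eq W L hQe]
  rw [htr, ← smul_Aof W h2 L σ xQ (ξ.1 τ), ← hframe] at hA
  have hA1 : Aof (eL W h2 L) xQ (frame W h2 (ξ.1 σ)) ≠ 0 := Aof_ne_zero hx _
  have hA2 : σ • Aof (eL W h2 L) xQ (frame W h2 (ξ.1 τ)) ≠ 0 := by
    rw [smul_ne_zero_iff_ne]; exact Aof_ne_zero hx _
  have hA3 : Aof (eL W h2 L) xQ (frame W h2 (ξ.1 (σ * τ))) ≠ 0 := Aof_ne_zero hx _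
  have hs1 := sL_ne_zero W h2 L (frame W h2 (ξ.1 σ))
  have hs2 : σ • sL W h2 L (frame W h2 (ξ.1 τ)) ≠ 0 := by
    rw [smul_ne_zero_iff_ne]; exact sL_ne_zero W h2 L _
  have hs3 := sL_ne_zero W h2 L (frame W h2 (ξ.1 (σ * τ)))
  have htab : tableOf (eL W h2 L) (frame W h2 (ξ.1 σ)) (frame W h2 (absGaloisRestrict K L σ • ξ.1 τ))
      = Aof (eL W h2 L) xQ (frame W h2 (ξ.1 (σ * τ)))
        / (Aof (eL W h2 L) xQ (frame W h2 (ξ.1 σ)) * σ • Aof (eL W h2 L) xQ (frame W h2 (ξ.1 τ))) := by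
    rw [eq_div_iff (mul_ne_zero hA1 hA2), ← hA]
    ring
  have hsd : ∀ a b : AlgebraicClosure L, σ • (a / b) = σ • a / σ • b := fun a b => by
    rw [div_eq_mul_inv, smul_mul', smul_inv'', div_eq_mul_inv]
  rw [htab, hsd]
  field_simp

end Cocycle

end ThetaLevelTwo

end Literature.NumberTheory.EllipticCurves
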